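import Mathlib
import Summits.AtomisticToContinuum.HydrodynamicLimit.Theses.ImplosionDichotomy
import Summits.AtomisticToContinuum.HydrodynamicLimit.Theorems.ImplosionDichotomyDenseExcursionR2Package
import Summits.AtomisticToContinuum.HydrodynamicLimit.Theorems.ImplosionDichotomyHsEosLowDensity

/-!
# Line `packing-analytic-implosion` — skeleton v1 for crux `DenseExcursion` (stmt-AtomisticToContinuum-12586)

Route `ImplosionDichotomy`, crux (rank 2)
`Summit.AtomisticToContinuum.HydrodynamicLimit.Theses.ImplosionDichotomy.DenseExcursion`; idea card
`Cruxes/DenseExcursion/Ideas/packing-analytic-implosion.md` (ideator 5, round 2; triage r2-1 / r2-2: pass, pass);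
line card `Lines/packing-analytic-implosion.md`. Planner `cruxplan-…-12586-packing-analytic-imp` (2026-08-17).

## The line in one paragraph

The hard-sphere gas implodes ALONG ITS OWN VIRIAL SERIES. In the self-similar variables of the pinned monatomic profile
`SS(r) = (W, S)` (BCG window, `(1,2)` strip package) the reduced hard-sphere Euler system in the packing variable is
`σ`-free, and its hs-isentropic closure is the `2 × 2` system
`s_τ = (w−1)s_x + (s/3)w_x + s(2w−r)`, `w_τ = (w−1)w_x + w² − rw + 3s(s_x + s)·M(G e^{3x} s³)`, `G = G₀e^{μτ}`,
`μ = 3(r−1)`, with the isentropic stiffening factor `M = Π + (3/5)φΠ′`, `Π = e^{(2/3)F}(1 + φF′)` of the hard-sphere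
excess free energy `F` (`HsEosLowDensity`, PROVED: `F` analytic near `0`). The object of the line is the ANALYTIC PACKING
IMPLOSION `Γ(G, x) = SS(x) + Σ_{k≥1} Gᵏ X_k(x)`: an exact eternal solution `(w, s)(G₀e^{μτ}, x)` of that system
emanating from `SS` at `τ = −∞`, analytic in the central packing `G` — the parameterisation-method representative of
the slow unstable packing direction of the autonomous extended system `(X, G)`, `G′ = μG`, solvable order by order
because `kμ ∉ {Λ₁, r}` (`2μ < Λ₁ < 3μ` is the package; `kμ ≠ r` the gauge clause — PROVED below as
`packing_nonresonance`) and convergent by a majorant argument on top of uniform large-real-`Λ` resolvent bounds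
(ratio test run to order 44 by both triagers: geometric, radius `≈ 0.09` in `G` at the sonic point). SHADOWING `Γ`
instead of tracking `SS` under a growing `O(packing)` forcing makes the `σ > 0` half of the heart FORCING-FREE: relative
to `Γ` the `σ`-problem has no forcing at all, only an `O(σ³)` data mismatch with explicit jets. What remains of the heart
(`stub_shadowingChart`) is the UNFORCED codimension-one stability of the exact solution `Γ` in shooting form (trapping
window `|a − a*(σ)| ≲ (σ³/η)^{Λ₁/μ}`), the two-jet of the threshold `a*(σ) = a₀ + σ³a₁ + σ⁶a₂ + O(σ^{3Λ₁/μ})`, and the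
common zero of `(a₁, a₂)` on the thickened Kidder knob — delivered as ONE typed interface `ShadowingChart` from which
the crux follows here by kernel-checked topology (intermediate value theorem along the zero curve of `a₁`) and
arithmetic (`η := min η₀ (c/C)^{μ/Λ₁}`), through the landed flow-free form `TunedPacking ↔ DenseExcursion`.

## Stubs (registered; `sorry` only inside them) and composition

* `stub_profilePackage` (P, XL, certified-numerics campaign; = the r2 line's `stub_profilePackage` v9 + the gauge
  non-resonance clause `∀ k, k·3(r−1) ≠ r`, void on the tree's pinned shooting window).
* `stub_largeRealResolvent` (L, M): no smooth mode and a smooth centre-regular resolvent `(Λ − L)⁻¹` for all large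
  REAL `Λ` — the qualitative linear input of the hierarchy at every high order (triage r2-1 sharpen 3; the quantitative
  `1/Λ` gain lives inside stub A, in the norms of its majorant scheme — see §0d for why it is not typed here).
* `stub_analyticPackingImplosion` (A, M–L, THE LEVER): P's data + L + `F` analytic with `F 0 = 0` ⇒
  `AnalyticPackingImplosion r W S (stiffening F)`.
* `stub_shadowingChart` (H′, XL, residual heart, forcing-free): P's data + Γ for every analytic `F` ⇒
  `Nonempty ShadowingChart`.
* Composition `DenseExcursion_of : DenseExcursion` — real proof, no `sorry`, no hypothesis.

Why H′ is one stub and not three (recorded honestly; line card §"Definition requests"): the Melnikov functionals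
`a₁, a₂` have no typed formula today (no Riesz projection / linearised-evolution vocabulary for `L = (linW, linS)`), and
the `σ = 0` stable-leaf selection is non-constructive, so the data family is `∃`-bound and every statement about ITS
functionals (signs, zero curve) must sit inside the same `∃`. The first condition alone IS typable by the Fredholm
alternative (`d ∈ Range(L − Λ₁)` via the landed `IsGeneralizedMode`) — noted for the lead.

Disproof used (`Cruxes/DenseExcursion/Disproof.lean`, gen 4): §3 `denseExcursion_iff_pde` (the line lives in the pinned
PDE form; `ReachesAt` below is its fixed-`σ` clause in the landed `EosRelated` dress of `TunedPacking`); §4 antitonicity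
in `η` (the chart's window is stated for every `η ≤ η₀`, which is what the composition exploits); §7/§11/§14 necessary
witness shape (packing manufactured dynamically from `O(σ³)` along a genuine implosion: every member of the chart is a
`σ`-independent smooth positive datum); §8 item 1 is exactly what H′ splits off from Γ; §8 item 5 / §13 (Boyd–Ramsey–Baty,
`athermal_scaling`): density-imploding self-similarity is broken at relative order packing — `Γ` is the object replacing
it (a series in `G`, not a profile). No `_false_without_` theorem constrains any stub; no stub is an instance of a landed
`Negative/*` lemma (AtTimeZero, Everywhere, Untied, Degenerate, CompressionBudget, EntropyTransport checked by name).
-/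

noncomputable section

open Filter Set MeasureTheory
open scoped Topology ContDiff

namespace Summit.AtomisticToContinuum.HydrodynamicLimit.Cruxes.DenseExcursion.PackingAnalyticImplosion

open Literature.MathematicalPhysics.KineticTheory
open Summit.AtomisticToContinuum.HydrodynamicLimit.Theses.ImplosionDichotomy
open Summit.AtomisticToContinuum.HydrodynamicLimit.Theorems.R2OneModeTwoConditions

/-! ### §0a The `(1,2)` package with the neutral strip (VERBATIM from the r2 skeleton v9, `Lines/r2_one_mode_two_conditions.lean`
§0a — a crux workfile, not importable; re-posited here so that ONE certificate serves both lines) -/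

/-- THE `(1, 2)` PACKAGE WITH THE NEUTRAL STRIP (r2 v8c, verbatim): `OneModeTwoConditions` (landed, `…R2Package.lean`)
with the exclusivity clause extended from `Re Λ > 0` to a strip `Re Λ > −δ₀`, `δ₀ > 0`, where the only extra smooth radial
mode is the scaling symmetry mode `Λ = 0`, which is simple. -/
def OneModeTwoConditionsStrip (r : ℝ) (W S : ℝ → ℝ) : Prop :=
  IsMonatomicProfile r W S ∧
  ∃ Λ₁ δ₀ : ℝ, 6 * (r - 1) < Λ₁ ∧ Λ₁ < 9 * (r - 1) ∧ 0 < δ₀ ∧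
    (∃ ŵ ŝ : ℝ → ℂ, IsSmoothRadialMode r W S (Λ₁ : ℂ) ŵ ŝ) ∧
    (∀ ŵ₁ ŝ₁ : ℝ → ℂ, IsSmoothRadialMode r W S (Λ₁ : ℂ) ŵ₁ ŝ₁ →
      ∀ ŵ₂ ŝ₂ : ℝ → ℂ, ¬ IsGeneralizedMode r W S (Λ₁ : ℂ) ŵ₁ ŝ₁ ŵ₂ ŝ₂) ∧
    (∀ Λ : ℂ, -δ₀ < Λ.re → (∃ ŵ ŝ : ℝ → ℂ, IsSmoothRadialMode r W S Λ ŵ ŝ) →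
      Λ = (Λ₁ : ℂ) ∨ Λ = (r : ℂ) ∨ Λ = 0) ∧
    (∀ ŵ ŝ : ℝ → ℂ, IsSmoothRadialMode r W S 0 ŵ ŝ →
      ∃ c : ℂ, ∀ x, ŵ x = c * ((deriv W x : ℝ) : ℂ) ∧ ŝ x = c * ((deriv S x : ℝ) : ℂ)) ∧
    (∀ ŵ₂ ŝ₂ : ℝ → ℂ,
      ¬ IsGeneralizedMode r W S 0 (fun x => ((deriv W x : ℝ) : ℂ)) (fun x => ((deriv S x : ℝ) : ℂ)) ŵ₂ ŝ₂)

/-- The strip package implies the landed package (r2 v8c, verbatim). -/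
theorem strip_imp_package {r : ℝ} {W S : ℝ → ℝ} (h : OneModeTwoConditionsStrip r W S) :
    OneModeTwoConditions r W S := by
  obtain ⟨hP, Λ₁, δ₀, h6, h9, hδ, hmode, hsimple, hstrip, -, -⟩ := h
  refine ⟨hP, Λ₁, h6, h9, hmode, hsimple, fun Λ hΛ hex => ?_⟩
  rcases hstrip Λ (by linarith) hex with h1 | h2 | h3
  · exact Or.inl h1
  · exact Or.inr h2
  · exact absurd hΛ (by rw [h3]; simp)

/-! ### §0b PACKING NON-RESONANCE (kernel-checked): order-by-order solvability of `Γ`'s hierarchy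

The `k`-th coefficient of `Γ` solves `(kμ − L) X_k = Src_k` with `μ = 3(r−1)`. By the package, the smooth radial point
spectrum in `Re Λ > 0` is `{Λ₁, r}`; `kμ = Λ₁` is impossible because `2μ < Λ₁ < 3μ` leaves no integer `k`, and `kμ = r`
(the blow-up-time gauge) is the explicit clause of `stub_profilePackage` (it happens only at `r = 9/8`, inside the BCG
statement window `(11/10, 227/200)` but outside the tree's pinned shooting window `[17307/15625, 89409/80000]`, where
`9(r−1) ≤ 1.0585 < r` and `12(r−1) ≥ 1.2918 > r`). So NO packing order resonates with a smooth mode. (The ideator's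
`packing_nonresonance_of_package`, re-typed against the landed vocabulary; triage r2-1/r2-2 re-proved the same.) -/

/-- No smooth radial mode sits at any packing order `kμ`, `k ≥ 1`, for a profile with the `(1,2)` package and the gauge
non-resonance `kμ ≠ r`. [folklore] -/
theorem packing_nonresonance {r : ℝ} {W S : ℝ → ℝ} (h : OneModeTwoConditions r W S)
    (hg : ∀ k : ℕ, (k : ℝ) * (3 * (r - 1)) ≠ r) :
    ∀ k : ℕ, 1 ≤ k → ∀ ŵ ŝ : ℝ → ℂ,
      ¬ IsSmoothRadialMode r W S (((k : ℝ) * (3 * (r - 1)) : ℝ) : ℂ) ŵ ŝ := by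
  intro k hk ŵ ŝ hmode
  obtain ⟨hP, Λ₁, h6, h9, -, -, hexcl⟩ := h
  have hr : 1 < r := hP.1
  have hk1 : (1 : ℝ) ≤ k := by exact_mod_cast hk
  have hμ : 0 < 3 * (r - 1) := by linarith
  have hpos : 0 < (k : ℝ) * (3 * (r - 1)) := mul_pos (by linarith) hμ
  rcases hexcl _ (by simpa using hpos) ⟨ŵ, ŝ, hmode⟩ with h1 | h2
  · -- `kμ = Λ₁` would force `2 < k < 3`
    have h1' : (k : ℝ) * (3 * (r - 1)) = Λ₁ := by exact_mod_cast h1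
    have hlt : (2 : ℝ) < k := by
      by_contra hle
      push Not at hle
      have := mul_le_mul_of_nonneg_right hle hμ.le
      linarith
    have hgt : (k : ℝ) < 3 := by
      by_contra hle
      push Not at hle
      have := mul_le_mul_of_nonneg_right hle hμ.le
      linarith
    have hk3 : (3 : ℝ) ≤ k := by
      have h2k : 2 < k := by exact_mod_cast hlt
      have h3k : 3 ≤ k := h2k
      exact_mod_cast h3k
    linarith
  · -- `kμ = r` is the excluded gauge resonance
    exact hg k (by exact_mod_cast h2)

/-- The gauge clause of `stub_profilePackage` is VOID on the tree's pinned shooting window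
`[17307/15625, 89409/80000] ∋ r₂` (`Literature.Analysis.FluidPDE.CompressibleEulerImplosionShooting.exists_meeting`):
there `9(r−1) < r < 12(r−1)`, so `k·3(r−1) ≠ r` for every `k` (the only resonant speed in the BCG statement window
`(11/10, 227/200)` is `r = 9/8`). Kernel-checked arithmetic, recorded for whoever pins the profile. [folklore] -/
theorem gauge_nonresonance_on_pinned_window {r : ℝ} (hlo : (17307 / 15625 : ℝ) ≤ r) (hhi : r ≤ 89409 / 80000)
    (k : ℕ) : (k : ℝ) * (3 * (r - 1)) ≠ r := by
  intro h
  have hμ : 0 < 3 * (r - 1) := by linarith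
  rcases le_or_gt k 3 with hk | hk
  · have hk' : (k : ℝ) ≤ 3 := by exact_mod_cast hk
    have := mul_le_mul_of_nonneg_right hk' hμ.le
    nlinarith
  · have hk' : (4 : ℝ) ≤ k := by exact_mod_cast hk
    have := mul_le_mul_of_nonneg_right hk' hμ.le
    nlinarith

/-! ### §0c The hard-sphere ISENTROPIC STIFFENING factor and the ANALYTIC PACKING IMPLOSION `Γ`

Along a hard-sphere isentrope `θ = K ρ^{2/3} e^{(2/3)F(φ)}` (`φ = ρσ³`, `F` = excess free energy per particle in units of
`θ`, `Z = 1 + φF′`), the pressure is `p = K ρ^{5/3} Π(φ)` with `Π = e^{(2/3)F}(1 + φF′)`, so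
`∂p/∂ρ|_s = (5/3)Kρ^{2/3}·M(φ)` with `M = Π + (3/5)φΠ′` (`M(0) = 1`, `M′(0) = 16π/9` for `F′(0) = 2π/3`): in the
self-similar isentropic variables `(w, sf)` of `…R2SelfSimilar` (`𝒫 = C‖ζ‖³sf³`, `sf` DEFINED from the density) the
mass equation is EOS-free and the pressure-gradient term of the momentum equation is the ideal one `3 sf (sf′ + sf)`
times `M(φ)`, `φ = 𝒫D³ = G e^{3x} sf³`, `G = C D(τ)³ = G₀ e^{μτ}`, `μ = 3(r − 1)`; the class is exactly invariant
(entropy transport, landed `EntropyTransportZ` / `Negative/EntropyTransport`). Seeking solutions that depend on `τ`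
only through `G` (`∂_τ = μG∂_G`) gives the two equations of `AnalyticPackingImplosion`. -/

/-- The isentrope pressure factor `Π_F(φ) = e^{(2/3)F(φ)} (1 + φ F′(φ))` of an excess free energy `F`. -/
def isentropePressureFactor (F : ℝ → ℝ) (φ : ℝ) : ℝ :=
  Real.exp (2 / 3 * F φ) * (1 + φ * deriv F φ)

/-- The hard-sphere ISENTROPIC STIFFENING factor `M_F(φ) = Π_F(φ) + (3/5) φ Π_F′(φ)`: the ratio of the real-gas to the
ideal-gas isentropic `∂p/∂ρ` at packing `φ` (`M_F(0) = 1`). -/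
def stiffening (F : ℝ → ℝ) (φ : ℝ) : ℝ :=
  isentropePressureFactor F φ + 3 / 5 * φ * deriv (isentropePressureFactor F) φ

/-- `M_F(0) = 1` whenever `F(0) = 0` (the ideal gas at zero packing). -/
theorem stiffening_zero {F : ℝ → ℝ} (hF : F 0 = 0) : stiffening F 0 = 1 := by
  simp [stiffening, isentropePressureFactor, hF]

/-- **THE ANALYTIC PACKING IMPLOSION `Γ`** of the profile `(r, W, S)` for the stiffening law `M` (typed target of the
line; the card's `[A]`, sharpened by triage r2-1 (2): centre regularity uniform in `G`, and stated for the hard-sphere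
`M = stiffening F` by the stubs). There are `g₀ > 0` and `w, s : (G, x) ↦ ℝ`, jointly `C^∞` on `(−g₀, g₀) × ℝ`,
ANALYTIC IN THE PACKING PARAMETER `G` at every `x`, equal to `(W, S)` at `G = 0`, with `s > 0`, CENTRE-REGULAR
uniformly in `G` (the radial fields `y ↦ w(G, log‖y‖) y` and `y ↦ ‖y‖ s(G, log‖y‖)` extend to fields on `ℝ³` jointly
smooth in `(G, y)`, the sound-speed field positive at the origin), solving the hs-isentropic self-similar system with
`∂_τ = μ G ∂_G`, `μ = 3(r−1)`:
`μG ∂_G s = (w−1) ∂_x s + (s/3) ∂_x w + s(2w − r)`,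
`μG ∂_G w = (w−1) ∂_x w + w² − r w + 3 s (∂_x s + s) · M(G e^{3x} s³)`.
Its time realisation `(w, s)(G₀e^{μτ}, x)` is an exact eternal classical solution emanating from `SS` at `τ = −∞`;
`G ↦ G e^{3x} s³` is the packing, `G` the central-packing parameter up to the factor `lim_{x→−∞} e^{3x}S³`. -/
def AnalyticPackingImplosion (r : ℝ) (W S : ℝ → ℝ) (M : ℝ → ℝ) : Prop :=
  ∃ g₀ : ℝ, 0 < g₀ ∧ ∃ w s : ℝ → ℝ → ℝ,
    ContDiffOn ℝ ∞ (fun p : ℝ × ℝ => w p.1 p.2) (Set.Ioo (-g₀) g₀ ×ˢ Set.univ) ∧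
    ContDiffOn ℝ ∞ (fun p : ℝ × ℝ => s p.1 p.2) (Set.Ioo (-g₀) g₀ ×ˢ Set.univ) ∧
    (∀ x, AnalyticOnNhd ℝ (fun G => w G x) (Set.Ioo (-g₀) g₀) ∧
      AnalyticOnNhd ℝ (fun G => s G x) (Set.Ioo (-g₀) g₀)) ∧
    (∀ x, w 0 x = W x ∧ s 0 x = S x) ∧
    (∀ G ∈ Set.Ioo (-g₀) g₀, ∀ x, 0 < s G x) ∧
    (∃ (Fv : ℝ → V3 → V3) (Gc : ℝ → V3 → ℝ),
      ContDiffOn ℝ ∞ (fun p : ℝ × V3 => Fv p.1 p.2) (Set.Ioo (-g₀) g₀ ×ˢ Set.univ) ∧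
      ContDiffOn ℝ ∞ (fun p : ℝ × V3 => Gc p.1 p.2) (Set.Ioo (-g₀) g₀ ×ˢ Set.univ) ∧
      (∀ G ∈ Set.Ioo (-g₀) g₀, 0 < Gc G 0) ∧
      ∀ G ∈ Set.Ioo (-g₀) g₀, ∀ y : V3, y ≠ 0 →
        w G (Real.log ‖y‖) • y = Fv G y ∧ ‖y‖ * s G (Real.log ‖y‖) = Gc G y) ∧
    ∀ G ∈ Set.Ioo (-g₀) g₀, ∀ x,
      3 * (r - 1) * G * deriv (fun G' => s G' x) G =
          (w G x - 1) * deriv (fun x' => s G x') x + s G x / 3 * deriv (fun x' => w G x') x +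
            s G x * (2 * w G x - r) ∧
      3 * (r - 1) * G * deriv (fun G' => w G' x) G =
          (w G x - 1) * deriv (fun x' => w G x') x + w G x ^ 2 - r * w G x +
            3 * s G x * (deriv (fun x' => s G x') x + s G x) * M (G * Real.exp (3 * x) * s G x ^ 3)

/-- SANITY (kernel-checked, not used below): for the IDEAL stiffening `M ≡ 1` the profile itself, frozen in `G`, is a
packing implosion in the sense of the equations — the two equations of `AnalyticPackingImplosion` with `M ≡ 1` at
`G`-independent `(w, s) = (W, S)` are literally the original-form profile equations. So the content of stub A is the `G`-dependence
forced by `M = stiffening F ≢ 1`. [folklore] -/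
theorem frozen_profile_solves {r : ℝ} {W S : ℝ → ℝ}
    (heqs : ∀ x, (W x - 1) * deriv W x + 3 * S x * deriv S x = r * W x - W x ^ 2 - 3 * S x ^ 2 ∧
      (1 - W x) * deriv S x - S x / 3 * deriv W x = S x * (2 * W x - r)) (G x : ℝ) :
    3 * (r - 1) * G * deriv (fun _ : ℝ => S x) G =
        (W x - 1) * deriv (fun x' => S x') x + S x / 3 * deriv (fun x' => W x') x + S x * (2 * W x - r) ∧
      3 * (r - 1) * G * deriv (fun _ : ℝ => W x) G =
        (W x - 1) * deriv (fun x' => W x') x + W x ^ 2 - r * W x +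
          3 * S x * (deriv (fun x' => S x') x + S x) * 1 := by
  obtain ⟨hM, hC⟩ := heqs x
  have e1 : (fun x' => S x') = S := rfl
  have e2 : (fun x' => W x') = W := rfl
  simp only [deriv_const, mul_zero, mul_one, e1, e2]
  constructor
  · linarith
  · linarith

/-! ### §0d The large-real-`Λ` resolvent of the linearised operator (conclusion type of stub L)

NORM-FREE BY DESIGN (planner's self-audit): in the coordinate `x = log y` centre-regular pairs are generally UNBOUNDED
in the sound-speed component (`ŝ ~ d₀e^{−x}` at the centre, like `S` itself and like the gauge mode `S′ + rS`), so a
sup-norm resolvent bound in `x` would be false as a statement about all regular pairs; the natural quantitative form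
(`sup|u₁| + sup eˣ|u₂| ≤ C (sup|f₁| + sup eˣ|f₂|)/Λ`, the `1/Λ` Laplace-transform gain, plus derivative control in
sonic- and centre-centred Taylor norms) depends on the function space in which stub A closes its majorant scheme and is
therefore proved INSIDE stub A. What is filed here is the qualitative half every order of `Γ`'s hierarchy needs. -/

/-- **LARGE-REAL-`Λ` RESOLVENT** (conclusion of `stub_largeRealResolvent`): there is `Λ₀` such that for every REAL
`Λ ≥ Λ₀` (i) the profile has no smooth radial mode at `Λ` (large-real-`Λ` exclusion), and (ii) `(Λ − L)` is ONTO smooth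
centre-regular real pairs: every smooth centre-regular real `f = (f₁, f₂)` (stated through the landed complex vocabulary
by coercion) has a smooth centre-regular real solution `u` of `Λu − Lu = f`, `L = (linW, linS)` — unique by (i). (For such
`Λ` the sonic Frobenius exponent `N(Λ) = (b − Λ)/κ` is negative, so the `C^∞` branch at the repulsive sonic point is
forced, and no boundary condition is needed in the supersonic far field.) -/
def LargeRealResolvent (r : ℝ) (W S : ℝ → ℝ) : Prop :=
  ∃ Λ₀ : ℝ, ∀ Λ : ℝ, Λ₀ ≤ Λ →
    (∀ ŵ ŝ : ℝ → ℂ, ¬ IsSmoothRadialMode r W S (Λ : ℂ) ŵ ŝ) ∧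
    ∀ f₁ f₂ : ℝ → ℝ, IsRegularPair (fun x => (f₁ x : ℂ)) (fun x => (f₂ x : ℂ)) →
      ∃ u₁ u₂ : ℝ → ℝ, IsRegularPair (fun x => (u₁ x : ℂ)) (fun x => (u₂ x : ℂ)) ∧
        ∀ x, (Λ : ℂ) * (u₁ x : ℂ) - linW r W S (fun y => (u₁ y : ℂ)) (fun y => (u₂ y : ℂ)) x = (f₁ x : ℂ) ∧
             (Λ : ℂ) * (u₂ x : ℂ) - linS r W S (fun y => (u₁ y : ℂ)) (fun y => (u₂ y : ℂ)) x = (f₂ x : ℂ)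

/-! ### §0e Reaching packing `η` at ONE diameter, and the SHADOWING CHART (conclusion type of the residual heart H′)

`ReachesAt η σ a₀ u₀ θ₀` is LITERALLY the fixed-`σ` clause of the landed `TunedPacking` (`…R2Package.lean`): the
classical hard-sphere Euler solution launched from THE `EosRelated` local-equilibrium density of the activity `a₀`
(`eosRelated_unique`, `eosRelated_rhoLim`) with `(u₀, θ₀)` reaches packing `η` on its interval of classical existence. -/

/-- Fixed-`σ` clause of `TunedPacking`: the pinned hard-sphere development of `(a₀, u₀, θ₀)` at diameter `σ` reaches
packing `η`. -/
def ReachesAt (η σ : ℝ) (a₀ : T3 → ℝ) (u₀ : T3 → V3) (θ₀ : T3 → ℝ) : Prop :=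
  ∃ n : T3 → ℝ, EosRelated σ a₀ n ∧
    ∃ (T : ℝ) (ρ θ : ℝ → T3 → ℝ) (u : ℝ → T3 → V3), IsHardSphereEulerSolution σ T ρ u θ ∧
      ρ 0 = n ∧ u 0 = u₀ ∧ θ 0 = θ₀ ∧ ∃ t ∈ Set.Ico 0 T, ∃ x, η ≤ ρ t x * σ ^ 3

/-- **SHADOWING CHART** — the typed interface delivered by the residual heart `stub_shadowingChart` (the card's
`[B] + [C] + [D]`, forcing-free around `Γ`). A THREE-PARAMETER family of `σ`-INDEPENDENT continuous positive data
`(a, b, β) ↦ (act, vel, temp)` on `𝕋³` — intended: the exact `SS(r)`-seed core datum, Kidder-sheared by the knob `b`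
(`ProjectiveCovariance`, landed), moved along a stable direction by `β`, and corrected by `a` times a fixed radial bump
pairing non-trivially with the unstable mode — together with
* `window` (UNFORCED CODIMENSION-ONE STABILITY OF `Γ`, shooting form): a threshold `aStar σ b β` such that for EVERY
  level `η ≤ η₀` and every `σ < σ₁`, each member with `|a − aStar σ b β| ≤ c (σ³/η)^ν` reaches packing `η` at diameter
  `σ` (its pinned hard-sphere development is trapped near the stable leaf of `Γ` until the central packing `G` of `Γ`
  has run from `O(σ³)` to `η`; the window is the unstable coordinate's budget `e^{−Λ₁(τ_η − τ₀)} = (κσ³/η)^{Λ₁/μ}`);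
* `jets` (THRESHOLD TWO-JET): `aStar σ b β = a0 b β + σ³ a1 b β + σ⁶ a2 b β + O(σ^{3ν})` with `2 < ν < 3`
  (`ν = Λ₁/μ`: orders `σ⁹` and beyond are inside the window — slaving, landed `SlavingODE`; `a0 b β` places the base
  member on the `σ = 0` stable leaf of `SS(r)`; `a1, a2` are the two Melnikov functionals, pairings of the datum's
  statics jets `h₁, h₂` (`TiedStatics`) and of `Γ`'s jets `X₁, X₂` against the leaf);
* `bZero`, `a1_zero` (FIRST TUNING by the knob): a continuous curve `b = bZero β` in the box along which `a1` vanishes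
  (the cubic `K₁(1 + bT)` of the Kidder knob has a transversal root; `b₀T ≈ −0.42` at `β = 0`, three codes);
* `a1_sign` (documents the knob: opposite strict signs of `a1` on the two `b`-edges of the box — the transversal root);
* `bottom`, `top` (SECOND TUNING, certified numerics): `a2` changes sign strictly along that curve between `βLo` and
  `βHi` (`G₂ = +0.09 → −0.015` across `β ∈ [0, 16 %]` along the sonic density bump, zero near `13.8 %`, c2-0).
Nothing here restates the crux: every field is a statement about ONE diameter at a time or about `σ`-free functions;
the crux (a `σ`-INDEPENDENT datum reaching a FIXED `η` along `σ → 0`) is extracted below by the intermediate value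
theorem and the choice `η := min η₀ (c/C)^{1/ν}`. -/
structure ShadowingChart where
  /-- knob box -/
  bLo : ℝ
  bHi : ℝ
  /-- stable-direction box -/
  βLo : ℝ
  βHi : ℝ
  hβ : βLo ≤ βHi
  /-- member `(a, b, β)`: activity, velocity and temperature data on `𝕋³` (all `σ`-independent) -/
  act : ℝ → ℝ → ℝ → T3 → ℝ
  vel : ℝ → ℝ → ℝ → T3 → V3
  temp : ℝ → ℝ → ℝ → T3 → ℝ
  cont : ∀ a b β, Continuous (act a b β) ∧ Continuous (vel a b β) ∧ Continuous (temp a b β)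
  pos : ∀ a b β x, 0 < act a b β x ∧ 0 < temp a b β x
  /-- window exponent `ν = Λ₁/μ`, top packing level `η₀`, diameter range `σ₁`, window and remainder constants -/
  ν : ℝ
  η₀ : ℝ
  σ₁ : ℝ
  c : ℝ
  C : ℝ
  hν : 2 < ν ∧ ν < 3
  hη₀ : 0 < η₀
  hσ₁ : 0 < σ₁
  hc : 0 < c
  hC : 0 < C
  /-- the trapping threshold in the corrector amplitude at diameter `σ` -/
  aStar : ℝ → ℝ → ℝ → ℝ
  /-- its jets: leaf position, first and second Melnikov functionals -/
  a0 : ℝ → ℝ → ℝ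
  a1 : ℝ → ℝ → ℝ
  a2 : ℝ → ℝ → ℝ
  window : ∀ η : ℝ, 0 < η → η ≤ η₀ → ∀ σ : ℝ, 0 < σ → σ < σ₁ →
    ∀ b ∈ Set.Icc bLo bHi, ∀ β ∈ Set.Icc βLo βHi, ∀ a : ℝ,
      |a - aStar σ b β| ≤ c * (σ ^ 3 / η) ^ ν → ReachesAt η σ (act a b β) (vel a b β) (temp a b β)
  jets : ∀ σ : ℝ, 0 < σ → σ < σ₁ → ∀ b ∈ Set.Icc bLo bHi, ∀ β ∈ Set.Icc βLo βHi,
    |aStar σ b β - (a0 b β + σ ^ 3 * a1 b β + σ ^ 6 * a2 b β)| ≤ C * (σ ^ 3) ^ ν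
  a2_cont : ContinuousOn (fun p : ℝ × ℝ => a2 p.1 p.2) (Set.Icc bLo bHi ×ˢ Set.Icc βLo βHi)
  /-- the zero curve of the first Melnikov functional (knob tuning) -/
  bZero : ℝ → ℝ
  bZero_cont : ContinuousOn bZero (Set.Icc βLo βHi)
  bZero_mem : ∀ β ∈ Set.Icc βLo βHi, bZero β ∈ Set.Icc bLo bHi
  a1_zero : ∀ β ∈ Set.Icc βLo βHi, a1 (bZero β) β = 0
  /-- the first Melnikov functional has opposite strict signs on the two knob edges (transversal root of the Kidder
  cubic; documents the knob tuning — not consumed by the composition, which reads the zero curve `bZero`) -/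
  a1_sign : ∀ β ∈ Set.Icc βLo βHi, a1 bLo β < 0 ∧ 0 < a1 bHi β
  /-- the second Melnikov functional changes sign STRICTLY along the zero curve of the first -/
  bottom : a2 (bZero βLo) βLo < 0
  top : 0 < a2 (bZero βHi) βHi

/-! ### §1 The stubs (registered; `sorry` only here) -/

/-- STUB P (CERTIFIED-NUMERICS INPUT, size XL — a campaign; shared with the r2 line): THE PINNED PROFILE WITH ITS `(1,2)`
STRIP PACKAGE AND THE GAUGE NON-RESONANCE. There is a globally smooth monatomic profile `(r, W, S)` in the BCG window
`11/10 < r < 227/200` with its two profile equations in original form, the `(1,2)` package with neutral strip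
(`OneModeTwoConditionsStrip`: unique genuine unstable smooth radial mode `Λ₁ ∈ (6(r−1), 9(r−1))`, algebraically
simple; no other smooth radial point spectrum in `Re Λ > −δ₀` besides the gauge `r` and the simple scaling mode `0`), and
no packing order on the gauge: `k·3(r−1) ≠ r` for all `k` (automatic once `r` is pinned to the tree's shooting window
`[17307/15625, 89409/80000] ∌ 9/8`: `9(r−1) < r < 12(r−1)` there). Conjuncts 1–3 and 5 are a certified-numerics campaign
on an existing engine (pin `r₂` by two more right-barrier certificates, Evans-function enclosure of `Λ₁ = 0.79711…`,
residue non-vanishing, kernel at `0`); conjunct 4 (exclusivity on the strip) additionally needs the `|Im Λ|`-confinement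
lemma of card `sonic-cavity-renewal` (F4 census j021194: no complex competitor in `[−3.6, 8] × [−100, 100]`).
Why plausibly true: six independent double-precision codes agree on the count; c3-0 strip scan; F4 argument-principle
census. Leans on: `stub_profileEqs stub_bcgProfile` (PROVED: conjunct 1 on the wide window), `IsSmoothRadialMode`,
`IsGeneralizedMode` (landed), the 32 kernel-certified Taylor-model windows `CompressibleEulerImplosionLeftTMW0..31`.
Sources: BuckmasterCaolaboraGomezserrano2025 Thm 1.1 + App. B, Biasi2021 §3, MerleEtAl2022 §3, NOTES-c5 §2, SpectrumC3.md,
TRIAGE-r2-2 (F4). -/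
theorem stub_profilePackage :
    ∃ (r : ℝ) (W S : ℝ → ℝ), (11 / 10 < r ∧ r < 227 / 200) ∧ IsMonatomicProfile r W S ∧
      (∀ x, (W x - 1) * deriv W x + 3 * S x * deriv S x = r * W x - W x ^ 2 - 3 * S x ^ 2 ∧
        (1 - W x) * deriv S x - S x / 3 * deriv W x = S x * (2 * W x - r)) ∧
      OneModeTwoConditionsStrip r W S ∧
      (∀ k : ℕ, (k : ℝ) * (3 * (r - 1)) ≠ r) := by
  sorry

/-- STUB L (size M; the FIRST LINEAR LEMMA of the line, the qualitative half of triage r2-1 sharpen (3)): LARGE-REAL-`Λ`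
RESOLVENT for the radial linearised operator of a smooth monatomic profile in the BCG window (`LargeRealResolvent`, §0d):
beyond some `Λ₀` there is no smooth radial mode, and `(Λ − L)u = f` has a (unique) smooth centre-regular solution for every
smooth centre-regular `f`. Proof plan: (i) exclusion — every smooth mode decays like `e^{−(Λ+r)x}` in the far field
(there `L ≈ −∂ₓ − r`), so the weighted energy identity of the repulsive profile bounds `Re Λ ≤ ω` (MerleEtAl2022 §3
dissipativity structure; c4-0's radial repulsivity margin 0.395 at `r₂` is the numerical instance); (ii) surjectivity —
on the closed core the inhomogeneous two-point SINGULAR boundary-value problem (centre: regular-singular, one-parameter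
affine family of regular local solutions; sonic point: regular-singular with exponents `{0, N(Λ)}`, `N(Λ) < 0` for large
`Λ`, one-parameter affine family of `C^∞` local solutions — Borel/Malgrange flat-remainder lemma for `C^∞` data) has a
solution iff the two homogeneous regular lines are transversal, i.e. iff there is no smooth mode; then continue the
solution through the regular region past `x_s` to `+∞` (outflow, all homogeneous solutions decay). Why plausibly true:
standard Evans-function/Fredholm theory for this ODE; numerically the Evans function has no real zero above the gauge `r`
(`RaceResults.md`, r1 real-axis scan `[−1.3, 3]`, c3-0). Leans on: `linW`, `linS`, `IsRegularPair`, `IsSmoothRadialMode`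
(landed `…R2Modes`), `IsMonatomicProfile`, Mathlib ODE (`ODE_solution_unique`, Picard–Lindelöf, Gronwall). Sources:
Biasi2021 §3 (Frobenius data at the sonic point), MerleEtAl2022 §3, arXiv:2605.00808 §1.10 (pointwise radial framework),
NUMERICS-c4.md (`N(Λ) = 3.30488 − 2.42615Λ` at `r₂`). -/
theorem stub_largeRealResolvent :
    ∀ (r : ℝ) (W S : ℝ → ℝ), 11 / 10 < r → r < 227 / 200 → IsMonatomicProfile r W S →
      (∀ x, (W x - 1) * deriv W x + 3 * S x * deriv S x = r * W x - W x ^ 2 - 3 * S x ^ 2 ∧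
        (1 - W x) * deriv S x - S x / 3 * deriv W x = S x * (2 * W x - r)) →
      LargeRealResolvent r W S := by
  sorry

/-- STUB A (THE LEVER of the line, size M–L): **THE HARD-SPHERE GAS IMPLODES ALONG ITS OWN VIRIAL SERIES.** For the pinned
profile with its `(1,2)` package, the gauge non-resonance and the large-real-`Λ` resolvent of stub L, and for EVERY excess
free energy `F` real-analytic on a neighbourhood `(−η₀, η₀)` of `0` with `F 0 = 0` (the hard-sphere one is supplied by the
PROVED `HsEosLowDensity`), the analytic packing implosion `Γ` exists for the stiffening law `M = stiffening F`
(`AnalyticPackingImplosion`, §0c). Proof plan (the card + triage r2-1 (3)/(4), r2-2 resonance audit): (i) formal series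
`Γ = SS + Σ_{k≥1} Gᵏ X_k`, `(kμ − L)X_k = Src_k(X_{<k}, ∂ₓX_{<k}; Taylor coefficients of M)` — solvable at EVERY order in
smooth centre-regular functions: no smooth mode at `kμ` (`packing_nonresonance`, PROVED above) + Fredholm alternative for
the Evans matching problem + sonic Frobenius non-resonance `N(kμ) ∉ {1, 2, …}` (closed-form check on the window from
`W₂(r) = (r − √(r²−6r+6))/2` and the slopes at `P₂`: `N(μ) ∈ (2.31, 2.83)`, `N(2μ) ≈ 1.66`, `N(3μ) ∈ (0.49, 0.99)`,
`N(kμ) < 1` for `k ≥ 4`; the `n = 0` near-degeneracy `N(4μ) ≈ 0.02` at `r₂` is a branch NORMALISATION, not a pole — the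
`2 × 2` sonic recursion keeps a one-parameter analytic family through `N = 0`); (ii) convergence by the majorant method:
`t_k ≤ C Σ_{i+j=k} t_i t_j` (sub-Catalan, geometric) in a norm combining weighted sup norms in the regular zones (the
QUANTITATIVE half of the resolvent lemma, proved here in the space of one's choosing: the Laplace-transform gain
`‖(kμ − L)⁻¹f‖ ≲ ‖f‖/(kμ)` in `(u₁, eˣu₂)`-weighted sup norms — outer WKB solution `u ≈ f/Λ` away from the degenerate
points — after which `∂ₓX_k = A⁻¹[(kμ − B)X_k − Src_k]` is bounded WITHOUT loss off the degenerate points) with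
sonic-centred and centre-centred Taylor norms (denominators `κ(n − N(kμ)) ≥ κ(n + 0.82k − 3.3)` and pivots `RS₀·k`:
no loss, `n/(n − N) ≤ 1`); stub L supplies the qualitative solvability at every order `kμ ≥ Λ₀`; `M = stiffening F` is analytic where `F` is, and `G e^{3x}s³` stays in its disc for
`|G| < g₀` because `e^{3x}S³` is bounded (→ `0.4655…` at the centre, `→ 0` in the far field); (iii) centre regularity and
positivity of `s` persist for `|G| < g₀` small. Numerics (cheapest falsifier, RUN by the ideator and BOTH triagers:
NUMERICS-i5b, kit j020953/j020988/j021006, j020910): hierarchy solved to order 44 in the hs-isentropic closure with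
Carnahan–Starling `M`; sup-norm ratios `11.6 ± 1.5` per order on converged configurations, i.e. radius `R_G ≈ 0.086`
(`g₀ ≈ 0.04` in central packing); no Gevrey tail. Why it might still fail: a hidden derivative loss at the centre/far-field
junctions of the three zones forcing Gevrey-1 growth beyond the computed orders (disfavoured by the data). Leans on:
`packing_nonresonance`, `LargeRealResolvent` (stub L), `IsMonatomicProfile`/`linW`/`linS` (landed), Mathlib
`AnalyticOnNhd`/`FormalMultilinearSeries` majorants (`HasFPowerSeriesOnBall`), `hsEosLowDensity_proof` (for the instance).
Sources: Cabré–Fontich–de la Llave 2003 (parameterisation method, slow non-resonant manifolds, analytic category; Indiana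
Univ. Math. J. 52), Baouendi–Goulaouic 1973 (Fuchsian Cauchy problems — nearest printed majorant technology; NOT directly
applicable: `L` carries `∂ₓ` at order `G⁰`), Boyd–Ramsey–Baty arXiv:1707.03792 (why `Γ` is a series and not a profile),
LebowitzPenrose1964 / Ruelle1969 §3.4 via `HsEosLowDensity` (PROVED), NUMERICS-i5b.md, TRIAGE-r2-1 `compute/RATIO-RERUN.md`. -/
theorem stub_analyticPackingImplosion :
    ∀ (r : ℝ) (W S : ℝ → ℝ), 11 / 10 < r → r < 227 / 200 → IsMonatomicProfile r W S →
      (∀ x, (W x - 1) * deriv W x + 3 * S x * deriv S x = r * W x - W x ^ 2 - 3 * S x ^ 2 ∧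
        (1 - W x) * deriv S x - S x / 3 * deriv W x = S x * (2 * W x - r)) →
      OneModeTwoConditions r W S → (∀ k : ℕ, (k : ℝ) * (3 * (r - 1)) ≠ r) →
      LargeRealResolvent r W S →
      ∀ (F : ℝ → ℝ) (η₀ : ℝ), 0 < η₀ → AnalyticOnNhd ℝ F (Set.Ioo (-η₀) η₀) → F 0 = 0 →
        AnalyticPackingImplosion r W S (stiffening F) := by
  sorry

/-- STUB H′ (THE RESIDUAL HEART, size XL, held by the lead; FORCING-FREE around `Γ`): **SHADOWING THE ANALYTIC PACKING
IMPLOSION.** For the pinned profile with its `(1,2)` strip package and gauge non-resonance, and GIVEN the analytic packing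
implosion `Γ` for every analytic excess free energy (stub A; instantiated inside at the `F` of `hsEosLowDensity_proof`, so
that `Γ` is an EXACT classical solution of the actual hard-sphere system in the isentropic class — `RadialReductionD` /
`SelfSimilarCovariance` / `EntropyTransportZ`, all landed), a `ShadowingChart` exists (§0e). Content, in the order a
lead would cut it once the Melnikov functionals are typed (definition request D1 of the line card):
(B) UNFORCED codimension-one nonlinear stability of the exact solution `Γ|_{G ≤ η₀}` in shooting form (Brouwer in the ONE
unstable coordinate `e₁`; `Γ` drifts by `O(η₀)` in `C^k`, so this is the finite-codimension stability theorem of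
MRRS 2022-II Thm 1.1 / CLGSS arXiv:2310.05325 Thm 1.2 / CSV arXiv:2605.00808 (radial) type with an `O(η₀)` COEFFICIENT
perturbation and NOTHING growing — but for `SS(r₂)` at `γ = 5/3`, whose repulsivity margins are so far numerical
(c4-0: radial 0.395, angular 0.648): printed template, unwritten instance = NOTES-c5 Delta 1), modulation of the gauge
and scaling symmetries (`gauge_isSmoothRadialMode`, `ScalingMode`, landed), existence on `𝕋³` by continuation with
exterior control (`HsChartReading`, `ChartRotationCovariance`, `ShrinkingBallLocality`, `ExteriorAgreement`,
`ExteriorDevelopment`, `stub_conditionalExistence` — all landed: NOTES-c5 Delta 5) ⇒ `window`;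
(C) the threshold two-jet `aStar = a0 + σ³a1 + σ⁶a2 + O(σ^{3ν})`, `ν = Λ₁/μ ∈ (2,3)`: finite-time analytic dependence of
the pinned data on `ε = σ³` (`TiedStatics`: `rhoLim = β + σ³h₁ + σ⁶h₂ + O(σ⁹)` in `C^k`) against the `C^{2,α}` pseudo-stable
leaf of the `Γ`-curve in the extended system (smooth to order `⌊ν⌋ = 2` along `G`, which is all that is used) ⇒ `jets`,
with `a1, a2` continuous on the box (for the exact-seed member: `a1 = ℓ₁(ĥ₁ − cX₁)`; along the knob a CUBIC in `1 + bT`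
by `ProjectiveCovariance`, landed; along `β` Melnikov integrals along the ideal orbit — triage r2-2 sharpen (1));
(D) selection and numerics: the base member lies on the `σ = 0` leaf after the correction `a0 b β` (Delta 3-graph), the
knob kills `a1` along a continuous curve `bZero` (transversal root of the cubic, `b₀T = −0.4234`, three codes) and `a2`
changes sign along it (`G₂`: `+0.0905` at `β = 0` to `−0.015` at `16 %`, zero near `13.8 %` along the sonic density bump —
c2-0's fate classifier; to be certified by interval `ε`-jets) ⇒ `bottom`, `top`.
Why it might fail: the sign change of `a2` along `{a1 = 0}` does not survive certification at `SS(r₂)` (then `SS(r₄)`,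
`J = 4`, and this chart needs two more jets), or the `γ = 5/3` repulsivity inequalities fail in the norm the bootstrap needs.
Costume check: no field of the chart restates the crux (each is fixed-`σ` or `σ`-free); the composition below does real
work (IVT + choice of `η`). Sources: MerleEtAl2022, CaolaboraEtAl2025 (arXiv:2310.05325 Thm 1.2, Rem 1.4–1.5),
ChenShkollerVicol2026 (arXiv:2605.00808 Thm 1.3, §1.10), BuckmasterCaolaboraGomezserrano2025, Biasi2021 §4,
Kidder1974 / Serre1997 (knob), Majda1984 + Dafermos2005 Thm 5.2.1 (continuation, cone locality), NOTES-c3 §Heart,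
NOTES-c4 (blueprint), NOTES-c5 §3, NOTES-c8 §3, NOTES-c2 (G₂), TRIAGE-r2-1/2. -/
theorem stub_shadowingChart :
    ∀ (r : ℝ) (W S : ℝ → ℝ), 11 / 10 < r → r < 227 / 200 → IsMonatomicProfile r W S →
      (∀ x, (W x - 1) * deriv W x + 3 * S x * deriv S x = r * W x - W x ^ 2 - 3 * S x ^ 2 ∧
        (1 - W x) * deriv S x - S x / 3 * deriv W x = S x * (2 * W x - r)) →
      OneModeTwoConditionsStrip r W S → (∀ k : ℕ, (k : ℝ) * (3 * (r - 1)) ≠ r) →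
      (∀ (F : ℝ → ℝ) (η₀ : ℝ), 0 < η₀ → AnalyticOnNhd ℝ F (Set.Ioo (-η₀) η₀) → F 0 = 0 →
        AnalyticPackingImplosion r W S (stiffening F)) →
      Nonempty ShadowingChart := by
  sorry

/-! ### §2 Composition (kernel-checked, no `sorry`, no hypothesis): the stubs give the crux BY NAME -/

/-- **THE TWICE-TUNED DATUM REACHES A FIXED PACKING ALONG `σ → 0`.** From a shadowing chart: the second tuning by the
intermediate value theorem along the zero curve of the first (`a1 = a2 = 0` at `(bZero β̄, β̄)`), the level
`η := min η₀ (c/C)^{1/ν}` making the two-jet remainder `C σ^{3ν}` fit inside the window `c (σ³/η)^ν` at EVERY small `σ`,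
and the window itself; the member `(a0 b̄ β̄, b̄, β̄)` is the `σ`-independent witness of `TunedPacking`. -/
theorem tunedPacking_of_chart (Ch : ShadowingChart) : TunedPacking := by
  -- second tuning: IVT for `β ↦ a2 (bZero β) β` on `[βLo, βHi]`
  have hgc : ContinuousOn (fun β => Ch.a2 (Ch.bZero β) β) (Set.Icc Ch.βLo Ch.βHi) := by
    have hmaps : Set.MapsTo (fun β => (Ch.bZero β, β)) (Set.Icc Ch.βLo Ch.βHi)
        (Set.Icc Ch.bLo Ch.bHi ×ˢ Set.Icc Ch.βLo Ch.βHi) := fun β hβ => ⟨Ch.bZero_mem β hβ, hβ⟩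
    have hpair : ContinuousOn (fun β => (Ch.bZero β, β)) (Set.Icc Ch.βLo Ch.βHi) :=
      Ch.bZero_cont.prodMk continuousOn_id
    exact Ch.a2_cont.comp hpair hmaps
  obtain ⟨β₀, hβ₀, hzero⟩ : ∃ β₀ ∈ Set.Icc Ch.βLo Ch.βHi, Ch.a2 (Ch.bZero β₀) β₀ = 0 :=
    intermediate_value_Icc Ch.hβ hgc ⟨Ch.bottom.le, Ch.top.le⟩
  have hb₀ : Ch.bZero β₀ ∈ Set.Icc Ch.bLo Ch.bHi := Ch.bZero_mem β₀ hβ₀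
  have h1 : Ch.a1 (Ch.bZero β₀) β₀ = 0 := Ch.a1_zero β₀ hβ₀
  have h2 : Ch.a2 (Ch.bZero β₀) β₀ = 0 := hzero
  -- the packing level
  have hν : 0 < Ch.ν := by linarith [Ch.hν.1]
  have hcC : 0 < Ch.c / Ch.C := div_pos Ch.hc Ch.hC
  set η : ℝ := min Ch.η₀ ((Ch.c / Ch.C) ^ (1 / Ch.ν)) with hηdef
  have hηpos : 0 < η := lt_min Ch.hη₀ (Real.rpow_pos_of_pos hcC _)
  have hηle : η ≤ Ch.η₀ := min_le_left _ _
  have hηpow : η ^ Ch.ν ≤ Ch.c / Ch.C := by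
    have hle : η ≤ (Ch.c / Ch.C) ^ (1 / Ch.ν) := min_le_right _ _
    calc η ^ Ch.ν ≤ ((Ch.c / Ch.C) ^ (1 / Ch.ν)) ^ Ch.ν := Real.rpow_le_rpow hηpos.le hle hν.le
      _ = Ch.c / Ch.C := by
          rw [← Real.rpow_mul hcC.le, one_div, inv_mul_cancel₀ hν.ne', Real.rpow_one]
  have hCη : Ch.C * η ^ Ch.ν ≤ Ch.c := by
    have h := mul_le_mul_of_nonneg_left hηpow Ch.hC.le
    have hC0 : Ch.C ≠ 0 := Ch.hC.ne'
    have e : Ch.C * (Ch.c / Ch.C) = Ch.c := by field_simp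
    linarith
  -- the witness
  refine ⟨η, hηpos, Ch.act (Ch.a0 (Ch.bZero β₀) β₀) (Ch.bZero β₀) β₀,
    Ch.temp (Ch.a0 (Ch.bZero β₀) β₀) (Ch.bZero β₀) β₀, Ch.vel (Ch.a0 (Ch.bZero β₀) β₀) (Ch.bZero β₀) β₀,
    (Ch.cont _ _ _).1, (Ch.cont _ _ _).2.2, (Ch.cont _ _ _).2.1, fun x => (Ch.pos _ _ _ x).1,
    fun x => (Ch.pos _ _ _ x).2, fun σ₀ hσ₀ => ?_⟩
  -- a diameter below both thresholds
  have hmin : 0 < min σ₀ Ch.σ₁ := lt_min hσ₀ Ch.hσ₁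
  have hσpos : 0 < min σ₀ Ch.σ₁ / 2 := half_pos hmin
  refine ⟨min σ₀ Ch.σ₁ / 2, hσpos, (half_lt_self hmin).trans_le (min_le_left _ _), ?_⟩
  have hσlt₁ : min σ₀ Ch.σ₁ / 2 < Ch.σ₁ := (half_lt_self hmin).trans_le (min_le_right _ _)
  -- the window applies because the two-jet remainder fits inside it
  refine Ch.window η hηpos hηle _ hσpos hσlt₁ _ hb₀ β₀ hβ₀ _ ?_
  have hj := Ch.jets _ hσpos hσlt₁ _ hb₀ β₀ hβ₀
  simp only [h1, h2, mul_zero, add_zero] at hj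
  rw [abs_sub_comm] at hj
  have hσ3 : 0 < (min σ₀ Ch.σ₁ / 2) ^ 3 := pow_pos hσpos 3
  have hx : 0 < ((min σ₀ Ch.σ₁ / 2) ^ 3) ^ Ch.ν := Real.rpow_pos_of_pos hσ3 _
  have hηx : 0 < η ^ Ch.ν := Real.rpow_pos_of_pos hηpos _
  calc |Ch.a0 (Ch.bZero β₀) β₀ - Ch.aStar (min σ₀ Ch.σ₁ / 2) (Ch.bZero β₀) β₀|
      ≤ Ch.C * ((min σ₀ Ch.σ₁ / 2) ^ 3) ^ Ch.ν := hj
    _ ≤ Ch.c * ((min σ₀ Ch.σ₁ / 2) ^ 3 / η) ^ Ch.ν := by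
        rw [Real.div_rpow hσ3.le hηpos.le, mul_div_assoc', le_div_iff₀ hηx]
        calc Ch.C * ((min σ₀ Ch.σ₁ / 2) ^ 3) ^ Ch.ν * η ^ Ch.ν
            = (Ch.C * η ^ Ch.ν) * ((min σ₀ Ch.σ₁ / 2) ^ 3) ^ Ch.ν := by ring
          _ ≤ Ch.c * ((min σ₀ Ch.σ₁ / 2) ^ 3) ^ Ch.ν := mul_le_mul_of_nonneg_right hCη hx.le

/-- `DenseExcursion` from the stubs, unconditionally: the pinned profile with its strip package (stub P), the large-real-`Λ`
resolvent (stub L), the analytic packing implosion for every analytic excess free energy (stub A, fed the landed package via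
`strip_imp_package`), the shadowing chart (stub H′), the kernel-checked tuning `tunedPacking_of_chart`, and the landed
flow-free form of the crux `tunedPacking_iff_denseExcursion` (p121667). -/
theorem DenseExcursion_of : DenseExcursion := by
  obtain ⟨r, W, S, ⟨hr₁, hr₂⟩, hprof, heqs, hpkg, hgauge⟩ := stub_profilePackage
  have hres : LargeRealResolvent r W S := stub_largeRealResolvent r W S hr₁ hr₂ hprof heqs
  have hΓ : ∀ (F : ℝ → ℝ) (η₀ : ℝ), 0 < η₀ → AnalyticOnNhd ℝ F (Set.Ioo (-η₀) η₀) → F 0 = 0 →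
      AnalyticPackingImplosion r W S (stiffening F) :=
    fun F η₀ hη₀ hF hF0 =>
      stub_analyticPackingImplosion r W S hr₁ hr₂ hprof heqs (strip_imp_package hpkg) hgauge hres F η₀ hη₀ hF hF0
  obtain ⟨Ch⟩ := stub_shadowingChart r W S hr₁ hr₂ hprof heqs hpkg hgauge hΓ
  exact tunedPacking_iff_denseExcursion.mp (tunedPacking_of_chart Ch)

end Summit.AtomisticToContinuum.HydrodynamicLimit.Cruxes.DenseExcursion.PackingAnalyticImplosion

end
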